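import Summits.AnomalousDissipation.AnomalousDissipation.Theorems.SolenoidalFractalHomogenisationLagrangianStepSidebandXEffGenInst
import Summits.AnomalousDissipation.AnomalousDissipation.Theorems.SolenoidalFractalHomogenisationLagrangianStepSidebandXApriori
import Summits.AnomalousDissipation.AnomalousDissipation.Theorems.SolenoidalFractalHomogenisationLagrangianStepSidebandXEnergyConstDefs
import Summits.AnomalousDissipation.AnomalousDissipation.Theorems.SolenoidalFractalHomogenisationLagrangianStepCellChainEnergy
import Summits.AnomalousDissipation.AnomalousDissipation.Theorems.SolenoidalFractalHomogenisationLagrangianStepD1Family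
import Summits.AnomalousDissipation.AnomalousDissipation.Theorems.SolenoidalFractalHomogenisationLagrangianStepD1TailBoundCore
import HarnessLib

/-!
# K1L_D `LagrangianRenormalisationStepDesign` (stmt-AnomalousDissipation-27980), `stub_D1_V0R` (ruling D27-1), brick T8e-1: PREPARATION OF THE ASSEMBLY —
# window conversions, the effective tensor of the clause at `c = 1/a`, the a priori bound of the slow mode, the response size on the window, the box radius
# (helper; `--kind proof --supports stmt-AnomalousDissipation-27980 --as helper`)

Summits-side helper file of route `SolenoidalFractalHomogenisation` (prover seat `ad-k1l-cellLawV-w1` g8; 0 sorry, no defs, no named facts).  Small facts the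
assembly of `stub_D1_V0R` (clause (i) ⇒ guarded clause (ii) of `WCrossing.D1ExactFamilyR`) consumes, in the vocabulary of the clause `SlowVectorClauseNoExF`:
* §1 `smul_inv_smul_tensor`, `nearIso_inv_smul`, `oddSmall_inv_smul` — the clause window `𝔸 ∈ ν·[lo/λ, hi·λ]`, `OddSmall 𝔸 (νβ)` in terms of `S = (1/ν)•𝔸`;
* §2 `effTensor_eq` — `(1/n²)•(𝔸 + ((1/a)/ν)•ΨB₁ a ν S) = (1/n²)•(𝔸 + (1/ν)•psiStar W₀ MB MB_pos ν S)`, `S = (1/ν)•𝔸` (the tensor of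
  `…SidebandXEffGenInst` with `ν•S` rewritten to `𝔸`);
* §3 `norm_modeRep_le_sqrt_energy` — `‖modeRep … ℓ s‖ ≤ √∫‖F‖²` on `[0,T]` (energy representative + `…SidebandXApriori`);
* §4 `xiCN_le_of_window` — `xiCN W₁ l ≤ 2·xiCf W₁·(1 + Λ/(4π²lo))/ν` for `ν·lo/Λ ≤ l`, `ν ≤ 1`;
* §5 `one_le_R0`, `nu_cube_mul_R0`, `abs_m_cubature_le_one` — the box radius `R0 ν = ⌈ν⁻³⌉₊` of `psiStar` and the cubature slot vectors;
* §6 `effGenC_clause_apply_of_transversal` (`hGx`), `norm_effGenC_clause_le` (`hGn`, in the atoms `ξ², xiCf, xiCN`), `effGenC_clause_coercive` (`hcoer`) —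
  the three generator hypotheses of the averaging step for `Ḡ = effGenC ((1/n²)•(𝔸 + (1/ν)•psiStar W₀ MB MB_pos ν S)) ℓ r₁`.
NOT a proof of any registered stub, of K1L_D, or of anomalous dissipation; rung F-D1.A0 infrastructure.
-/

set_option linter.dupNamespace false

noncomputable section

namespace Summit.AnomalousDissipation.AnomalousDissipation.Theorems.SolenoidalFractalHomogenisation.LagrangianStep.Sideband

open Set MeasureTheory
open scoped InnerProductSpace
open Literature.Analysis Literature.Analysis.FunctionSpaces Literature.Analysis.FunctionSpaces.Torus
open Literature.Analysis.FluidPDE Literature.Analysis.FluidPDE.Torus Literature.Analysis.FluidPDE.LatticeShear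
open Summit.AnomalousDissipation.AnomalousDissipation.Theorems
open Summit.AnomalousDissipation.AnomalousDissipation.Theorems.SolenoidalFractalHomogenisation.LagrangianStep
open Summit.AnomalousDissipation.AnomalousDissipation.Theorems.SolenoidalFractalHomogenisation.LagrangianStep.WCrossing
open Summit.AnomalousDissipation.AnomalousDissipation.Theorems.SolenoidalFractalHomogenisation.LagrangianStep.CellChain (modeRep exists_energyRep_cell)

variable {k₀ : ℕ}

/-! ## §1 Window conversions -/

/-- `ν • ((1/ν) • 𝔸) = 𝔸`. [folklore] -/
theorem smul_inv_smul_tensor {ν : ℝ} (hν : 0 < ν) (𝔸 : T4) : ν • ((1 / ν) • 𝔸) = 𝔸 := by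
  rw [smul_smul, mul_one_div_cancel hν.ne', one_smul]

/-- The clause window in terms of `S = (1/ν)•𝔸`: `NearIso S (lo/λ) (hi·λ)`. [cite: Giaquinta1983MultipleIntegrals, Ch. III §2 eq. (2.2)] -/
theorem nearIso_inv_smul {ν lo hi lam : ℝ} (hν : 0 < ν) {𝔸 : T4} (h : Torus.NearIso 𝔸 (ν * (lo / lam)) (ν * (hi * lam))) :
    Torus.NearIso ((1 / ν) • 𝔸) (lo / lam) (hi * lam) := by
  have h1 := h.smul (c := 1 / ν) (by positivity)
  exact nearIso_congr h1 (by field_simp) (by field_simp)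

/-- The clause odd-part bound in terms of `S = (1/ν)•𝔸`: `OddSmall S β`. [cite: Avron1998OddViscosity, §2 eq. (1)-(2)] -/
theorem oddSmall_inv_smul {ν β : ℝ} (hν : 0 < ν) {𝔸 : T4} (h : Torus.OddSmall 𝔸 (ν * β)) : Torus.OddSmall ((1 / ν) • 𝔸) β :=
  oddSmall_congr (h.smul (1 / ν)) (by field_simp)

/-! ## §2 The effective tensor of the clause at `c = 1/a` -/

/-- **The clause's effective tensor at `c = 1/a` is the tensor of `…SidebandXEffGenInst`**:
`(1/n²)•(𝔸 + ((1/a)/ν)•ΨB₁ a ν ((1/ν)•𝔸)) = (1/n²)•(ν•S + (1/ν)•psiStar W₀ MB MB_pos ν S)`, `S = (1/ν)•𝔸`. [cite: MajdaKramer1999, §2.2.1.3 (55)] -/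
theorem effTensor_eq {a ν : ℝ} (ha : 0 < a) (hν : 0 < ν) (n : ℕ) (𝔸 : T4) :
    (1 / (n:ℝ) ^ 2) • (𝔸 + (1 / a / ν) • ΨB₁ a ν ((1 / ν) • 𝔸)) =
      (1 / (n:ℝ) ^ 2) • (𝔸 + (1 / ν) • Sideband.psiStar cubatureWord MB MB_pos ν ((1 / ν) • 𝔸)) := by
  rw [ΨB₁_apply, smul_smul, show 1 / a / ν * a = 1 / ν by field_simp]

/-! ## §3 The a priori bound of the slow mode -/

/-- **`‖x s‖ ≤ √E₀`**: the slow mode of a weak solution of the cell problem (tensor `NearIso 𝔹 lo' hi'`, `lo' > 0`, datum `F ∈ L²` weakly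
divergence free) is bounded by `√∫‖F‖²` at EVERY `s ∈ [0,T]` (`n ≥ 1`). [cite: Temam1984, Ch. III §1 Lemma 1.2 (energy inequality)] -/
theorem norm_modeRep_le_sqrt_energy (W₁ : LatticeWord k₀) {n : ℕ} (hn : n ≠ 0) {T : ℝ} (hT : 0 < T) {𝔹 : T4} {lo' hi' : ℝ}
    (h𝔹 : Torus.NearIso 𝔹 lo' hi') (hlo' : 0 < lo')
    {F : UnitAddTorus (Fin 3) → EuclideanSpace ℝ (Fin 3)} {u : ℝ → UnitAddTorus (Fin 3) → EuclideanSpace ℝ (Fin 3)}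
    (hF2 : MemLp F 2 volume) (hFdiv : FunctionSpaces.Torus.IsWeaklyDivFree F)
    (h : Torus.IsWeakTensorPassiveVectorOn 0 T 𝔹 (W₁.cell n) F u) (ℓ : Fin 3 → ℤ) {s : ℝ} (hs : s ∈ Icc 0 T) :
    ‖modeRep W₁ n 𝔹 F u ℓ s‖ ≤ Real.sqrt (∫ x, ‖F x‖ ^ 2) := by
  obtain ⟨E, Q, hE0, -, hEc, hEanti, -, hEae, -, -, -, -, -⟩ := exists_energyRep_cell W₁ n hT h𝔹 hlo' hF2 hFdiv h
  have hFi : Integrable F volume := hF2.integrable one_le_two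
  have h1 := norm_sq_slow_add_sbVec_le W₁ hn hT h hFi hEc hEae ℓ 0 hs
  have h2 : E s ≤ E 0 := hEanti ⟨le_rfl, hT.le⟩ hs hs.1
  have h3 : ‖modeRep W₁ n 𝔹 F u ℓ s‖ ^ 2 ≤ ∫ x, ‖F x‖ ^ 2 := by
    rw [← hE0]; nlinarith [sq_nonneg ‖sbVec W₁ n 𝔹 F u ℓ 0 s‖]
  exact Real.le_sqrt_of_sq_le h3

/-! ## §4 The response size on the clause window -/

/-- **`xiCN W₁ l ≤ 2·xiCf W₁·(1 + Λ/(4π²lo))/ν`** on the clause window `ν·lo/Λ ≤ l`, `ν ≤ 1`. [cite: SandersVerhulstMurdock2007, Lemma 5.2.7 (linear case)] -/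
theorem xiCN_le_of_window (W₁ : LatticeWord k₀) {l ν lo Λ : ℝ} (hl : 0 < l) (hν : 0 < ν) (hν1 : ν ≤ 1) (hlo : 0 < lo) (hΛ : 0 < Λ)
    (h : ν * (lo / Λ) ≤ l) : xiCN W₁ l ≤ 2 * xiCf W₁ * (1 + Λ / (4 * Real.pi ^ 2 * lo)) / ν := by
  have hm : 0 < min 1 (4 * Real.pi ^ 2 * l) := lt_min one_pos (by positivity)
  have hsum : xiCN W₁ l = 2 * xiCf W₁ * (1 / min 1 (4 * Real.pi ^ 2 * l)) := by
    rw [xiCN_def, xiCf_def, Finset.mul_sum, Finset.sum_mul]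
    exact Finset.sum_congr rfl fun j _ => by field_simp; ring
  -- `1/min(1, 4π²l) ≤ (1 + Λ/(4π²lo))/ν`
  have hw : 1 / l ≤ Λ / lo / ν := by
    rw [div_div, div_le_div_iff₀ hl (by positivity)]
    calc 1 * (lo * ν) = ν * (lo / Λ) * Λ := by field_simp
      _ ≤ l * Λ := by gcongr
      _ = Λ * l := mul_comm _ _
  have h1 : 1 / min 1 (4 * Real.pi ^ 2 * l) ≤ 1 + 1 / (4 * Real.pi ^ 2 * l) := by
    rcases le_total 1 (4 * Real.pi ^ 2 * l) with hc | hc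
    · rw [min_eq_left hc]; have : 0 ≤ 1 / (4 * Real.pi ^ 2 * l) := by positivity
      linarith
    · rw [min_eq_right hc]; linarith
  have h2 : 1 / (4 * Real.pi ^ 2 * l) ≤ Λ / (4 * Real.pi ^ 2 * lo) / ν := by
    calc 1 / (4 * Real.pi ^ 2 * l) = 1 / (4 * Real.pi ^ 2) * (1 / l) := by field_simp
      _ ≤ 1 / (4 * Real.pi ^ 2) * (Λ / lo / ν) := mul_le_mul_of_nonneg_left hw (by positivity)
      _ = Λ / (4 * Real.pi ^ 2 * lo) / ν := by field_simp
  have h3 : (1:ℝ) ≤ 1 / ν := by rw [le_div_iff₀ hν]; linarith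
  have h4 : 1 / min 1 (4 * Real.pi ^ 2 * l) ≤ (1 + Λ / (4 * Real.pi ^ 2 * lo)) / ν := by
    calc 1 / min 1 (4 * Real.pi ^ 2 * l) ≤ 1 + 1 / (4 * Real.pi ^ 2 * l) := h1
      _ ≤ 1 / ν + Λ / (4 * Real.pi ^ 2 * lo) / ν := add_le_add h3 h2
      _ = (1 + Λ / (4 * Real.pi ^ 2 * lo)) / ν := by ring
  rw [hsum]
  calc 2 * xiCf W₁ * (1 / min 1 (4 * Real.pi ^ 2 * l)) ≤ 2 * xiCf W₁ * ((1 + Λ / (4 * Real.pi ^ 2 * lo)) / ν) :=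
        mul_le_mul_of_nonneg_left h4 (by have := xiCf_nonneg W₁; positivity)
    _ = _ := by ring

/-! ## §5 The box radius `R0 ν` and the cubature slot vectors -/

/-- `1 ≤ R0 ν` for `0 < ν ≤ 1`. [folklore] -/
theorem one_le_R0 {ν : ℝ} (hν : 0 < ν) (hν1 : ν ≤ 1) : 1 ≤ R0 ν := by
  unfold R0
  have h1 : (1:ℝ) ≤ (1 / ν) ^ 3 := one_le_pow₀ (by rw [le_div_iff₀ hν]; linarith)
  exact Nat.one_le_iff_ne_zero.mpr fun h0 => by have := Nat.ceil_eq_zero.mp h0; linarith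

/-- `1 ≤ ν³·R0 ν` for `ν > 0`. [folklore] -/
theorem nu_cube_mul_R0 {ν : ℝ} (hν : 0 < ν) : 1 ≤ ν ^ 3 * (R0 ν : ℝ) := by
  unfold R0
  have h1 : (1 / ν) ^ 3 ≤ (⌈(1 / ν) ^ 3⌉₊ : ℝ) := Nat.le_ceil _
  have h2 := mul_le_mul_of_nonneg_left h1 (by positivity : (0:ℝ) ≤ ν ^ 3)
  rwa [show ν ^ 3 * (1 / ν) ^ 3 = 1 by field_simp] at h2

/-- The cubature slot vectors have sup-norm `≤ 1` (entries in `{0, ±1}`), also after stretching. [folklore] -/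
theorem abs_m_cubature_le_one (M : ℝ) (hM : 0 < M) (s : ℝ) (hs : 0 < s) (j : Fin 26) (i : Fin 3) :
    |(((cubatureWord.stretch M hM).stretch s hs).phase j).m i| ≤ ((1 : ℕ) : ℤ) := by
  have hm : (((cubatureWord.stretch M hM).stretch s hs).phase j).m = (slots j).m := rfl
  rw [hm]
  rcases D1Tail.slots_m_entry j i with h | h | h <;> rw [h] <;> decide

/-! ## §6 The three generator hypotheses of the averaging step, in clause form -/

/-- **`hGx`**: on transversal `v`, `Ḡ v = 4π²P_ℓT_{((1/n²)𝔸)ᵀ}(ℓ)v + slowMean W₁ n ℓ 𝔸 (R0 ν) v` (`W₁ = (W.stretch M hM).stretch (1/ν)`).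
[cite: MajdaKramer1999, §2.2.1.3 (55)] -/
theorem effGenC_clause_apply_of_transversal (W : LatticeWord k₀) (M : ℝ) (hM : 0 < M) {ν : ℝ} (hν : 0 < ν) {𝔸 : T4}
    {lo' hi' : ℝ} (h𝔸 : Torus.NearIso 𝔸 lo' hi') (hlo' : 0 < lo') {n : ℕ} (hn : n ≠ 0) (ℓ : Fin 3 → ℤ) (r₁ : ℝ)
    {v : EuclideanSpace ℂ (Fin 3)} (hv : transversalProj ℓ v = v) :
    effGenC ((1 / (n : ℝ) ^ 2) • (𝔸 + (1 / ν) • psiStar W M hM ν ((1 / ν) • 𝔸))) ℓ r₁ v =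
      (((4 * Real.pi ^ 2 : ℝ) : ℂ)) • transversalProj ℓ (Torus.symbT (Torus.majorTranspose ((1 / (n : ℝ) ^ 2) • 𝔸)) ℓ v) +
        slowMean ((W.stretch M hM).stretch (1 / ν) (one_div_pos.mpr hν)) n ℓ 𝔸 (R0 ν) v := by
  have hS : Torus.NearIso (ν • ((1 / ν) • 𝔸)) lo' hi' := by rwa [smul_inv_smul_tensor hν]
  have h := effGenC_effTensor_apply_of_transversal W M hM hν hS hlo' hn ℓ r₁ hv
  rw [smul_inv_smul_tensor hν] at h
  exact h

/-- **`hGn`** in the atoms of the assembly: `‖Ḡ‖ ≤ 4π²ξ²·(ν hb₀) + ξ²·xiCf W₁·xiCN W₁ lo' + 2r₁` (`ξ = √|ℓ|²/n`, `NearIso 𝔸 lo' hi'`, `OddSmall 𝔸 β'`,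
`hi' + β'/2 ≤ ν·hb₀`, `r₁ ≥ 0`). [cite: MajdaKramer1999, §2.2.1.3 (55)] -/
theorem norm_effGenC_clause_le (W : LatticeWord k₀) (M : ℝ) (hM : 0 < M) {ν : ℝ} (hν : 0 < ν) {𝔸 : T4}
    {lo' hi' β' hb₀ : ℝ} (h𝔸 : Torus.NearIso 𝔸 lo' hi') (hlo' : 0 < lo') (hhi' : 0 ≤ hi') (hO : Torus.OddSmall 𝔸 β') (hβ' : 0 ≤ β')
    (hhb : hi' + β' / 2 ≤ ν * hb₀) {n : ℕ} (hn : n ≠ 0) (ℓ : Fin 3 → ℤ) {r₁ : ℝ} (hr₁ : 0 ≤ r₁) :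
    ‖effGenC ((1 / (n : ℝ) ^ 2) • (𝔸 + (1 / ν) • psiStar W M hM ν ((1 / ν) • 𝔸))) ℓ r₁‖ ≤
      4 * Real.pi ^ 2 * (Real.sqrt (freqNormSq ℓ) / n) ^ 2 * (ν * hb₀) +
        (Real.sqrt (freqNormSq ℓ) / n) ^ 2 * xiCf ((W.stretch M hM).stretch (1 / ν) (one_div_pos.mpr hν)) *
          xiCN ((W.stretch M hM).stretch (1 / ν) (one_div_pos.mpr hν)) lo' + 2 * r₁ := by
  have hS : Torus.NearIso (ν • ((1 / ν) • 𝔸)) lo' hi' := by rwa [smul_inv_smul_tensor hν]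
  have hOS : Torus.OddSmall (ν • ((1 / ν) • 𝔸)) β' := by rwa [smul_inv_smul_tensor hν]
  have h := norm_effGenC_effTensor_le W M hM hν hS hlo' hhi' hOS hβ' hn ℓ r₁
  rw [smul_inv_smul_tensor hν] at h
  have hn0 : (0 : ℝ) < n := by exact_mod_cast Nat.pos_of_ne_zero hn
  have hξ : (Real.sqrt (freqNormSq ℓ) / n) ^ 2 = freqNormSq ℓ / (n : ℝ) ^ 2 := by
    rw [div_pow, Real.sq_sqrt (freqNormSq_nonneg ℓ)]
  have h1 : 4 * Real.pi ^ 2 * (1 / (n : ℝ) ^ 2 * hi' + 1 / (n : ℝ) ^ 2 * β' / 2) * freqNormSq ℓ ≤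
      4 * Real.pi ^ 2 * (Real.sqrt (freqNormSq ℓ) / n) ^ 2 * (ν * hb₀) := by
    rw [hξ]
    have e : 4 * Real.pi ^ 2 * (1 / (n : ℝ) ^ 2 * hi' + 1 / (n : ℝ) ^ 2 * β' / 2) * freqNormSq ℓ =
        4 * Real.pi ^ 2 * (freqNormSq ℓ / (n : ℝ) ^ 2) * (hi' + β' / 2) := by
      field_simp
    rw [e]
    exact mul_le_mul_of_nonneg_left hhb (by have := freqNormSq_nonneg ℓ; positivity)
  have h2 : 2 * |r₁| = 2 * r₁ := by rw [abs_of_nonneg hr₁]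
  rw [← xiCf_def, ← xiCN_def, h2] at h
  linarith

/-- **`hcoer`** for the cubature word at width `B₁` on the guarded window, in clause form: with
`r₁ = 4π²·(1/n²)(ν·lo/λ + cψ/ν)·|ℓ|²`, `cψ = (1−ρB)(97/100)((3/10)c₀)/(11/10)`, `r₁‖v‖² ≤ ⟪Ḡ v, v⟫_ℝ`. [cite: MajdaKramer1999, §2.2.1.3 (55)] -/
theorem effGenC_clause_coercive {a : ℝ} (ha : 0 < a)
    (hres : ∀ ν ∈ Set.Ioc 0 νB₁, ∀ S : T4, Torus.NearIso S (10 / 11) (11 / 10) → ∀ τ ∈ Set.Icc (0:ℝ) (1 / 20), OddSectorial S τ →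
      RelSmall (ΨB₁ a ν S - ΦB a S) (ΦB a S) ρB)
    {lo hi ΛV β lam : ℝ} (hlo : 0 < lo) (hlh : lo ≤ hi) (h1 : hi * ΛV ≤ 11 / 10) (h2 : 10 / 11 * ΛV ≤ lo) (hβ0 : 0 ≤ β)
    (hβ : β * ΛV ≤ lo / 20) (hlam : lam ∈ Set.Icc 1 ΛV) {𝔸 : T4} {ν : ℝ} (hν : ν ∈ Set.Ioc 0 νB₁)
    (hN : Torus.NearIso 𝔸 (ν * (lo / lam)) (ν * (hi * lam))) (hO : Torus.OddSmall 𝔸 (ν * β))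
    (n : ℕ) (ℓ : Fin 3 → ℤ) (v : EuclideanSpace ℂ (Fin 3)) :
    4 * Real.pi ^ 2 * (1 / (n : ℝ) ^ 2 * (ν * (lo / lam) + (1 - ρB) * (97 / 100) * (3 / 10 * c0) / (11 / 10) / ν)) * freqNormSq ℓ * ‖v‖ ^ 2 ≤
      ⟪effGenC ((1 / (n : ℝ) ^ 2) • (𝔸 + (1 / ν) • Sideband.psiStar cubatureWord MB MB_pos ν ((1 / ν) • 𝔸))) ℓ
          (4 * Real.pi ^ 2 * (1 / (n : ℝ) ^ 2 * (ν * (lo / lam) + (1 - ρB) * (97 / 100) * (3 / 10 * c0) / (11 / 10) / ν)) * freqNormSq ℓ) v,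
        v⟫_ℝ := by
  have hN' := nearIso_inv_smul hν.1 hN
  have hO' := oddSmall_inv_smul hν.1 hO
  have h := effGenC_effTensor_coercive ha hres hlo hlh h1 h2 hβ0 hβ hlam hN' hO' hν n ℓ v
  rw [smul_inv_smul_tensor hν.1] at h
  exact h

end Summit.AnomalousDissipation.AnomalousDissipation.Theorems.SolenoidalFractalHomogenisation.LagrangianStep.Sideband

end
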